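import Summits.MatrixMultiplication.OmegaCensus.DominoZpZpStructSixWideCore
import Summits.MatrixMultiplication.OmegaCensus.DominoZpZpStructSix
import HarnessLib

/-!
# Structural cover theorem for part size `6` on `ZMod p × ZMod p`, every odd prime `p`: the distinct-directions check and assembly

ω-census `pub-omega`, family (b3), seat pub-omega-group gen 25.  Framing: lottery ticket; floor = certified bounds/negative
ranges.  VALUE: with `DominoZpZpStructSixWideCore.lean`, the part-`6` structural route (`DominoZpZpStructSix*.lean`, gen 23) no
longer needs `p + 1 < 15`; aimed at the OPEN census cells `(1,6,16)@289` (`A = ℤ₁₇²`) and `(1,6,20)@361` (`A = ℤ₁₉²`); NOT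
progress on ω.

* the finite PAIR CHECK of the distinct-directions family (hypothesis `h3c` of `exists_goodS_wide`): `x`-arrangements from
  `arr6Y3` (`x₀ = x₃`) filtered by `sdX6` (no other coincidence, positions `1,4,5` sorted), `y`-arrangements from `arr6Y2`
  (`y₀ = y₂`) filtered by `dY6` (no other coincidence); `checkH6c`, batched `checkH6xs`, and the soundness theorem
  `h3c_of_checkH6c` (scale both tuples into the representatives `R`, then sort positions `1,4,5` by a relabelling fixing
  `0,2,3` — both families are closed under these moves, and keys are invariant);
* `exists_entry_structSixWide_of_checks` — the scaled cover hypothesis of `DominoZpZpCells` for `|X| = 6` from Bool checks, as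
  `exists_entry_structSix_of_checks` but with the `h3c` check in place of `p + 1 < 15`.

Sizes (exact desk check, pub-omega-group-g25 `code/s6w_check.py`): per `2+1+1+1+1` representative `4` sorted `x`-arrangements,
`24` `y`-arrangements; `p = 17`: `200 × 1200` configurations, `p = 19`: `180 × 1080`, all with `≥ 3` good pairs.
-/

namespace Summit.MatrixMultiplication.OmegaCensus

open Finset

namespace ZpZpDomino

/-! ## Programs -/

section Program

/-- The index pairs of `pairs15` are increasing. [folklore] -/
theorem pairs15_lt : ∀ ij ∈ pairs15, ij.1 < ij.2 := by decide

/-- `x`-arrangements of the distinct-directions family: the only coincidence is `x₀ = x₃`, and positions `1,4,5` are sorted. [folklore] -/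
def sdX6 (xs : List ℕ) : Bool :=
  (pairs15.all fun ij => (ij == (0, 3)) || !(xs.getD ij.1 0 == xs.getD ij.2 0)) &&
    (decide (xs.getD 1 0 < xs.getD 4 0) && decide (xs.getD 4 0 < xs.getD 5 0))

/-- `y`-arrangements of the distinct-directions family: the only coincidence is `y₀ = y₂`. [folklore] -/
def dY6 (ys : List ℕ) : Bool :=
  pairs15.all fun ij => (ij == (0, 2)) || !(ys.getD ij.1 0 == ys.getD ij.2 0)

/-- The pair check of the distinct-directions family `c` for one representative `k₁` against the `y`-arrangement list `YS`. [folklore] -/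
def checkH6c (p : ℕ) (et : BTree) (YS : List (List ℕ)) (k₁ : List ℕ) : Bool :=
  ((arr6Y3 p k₁).filter sdX6).all fun xs => YS.all fun ys => pairGood6 p et xs ys

/-- Batched `x`-checks: every `x`-arrangement of the list `XS` against `YS` (the unit the per-prime files decide). [folklore] -/
def checkH6xs (p : ℕ) (et : BTree) (YS XS : List (List ℕ)) : Bool := XS.all fun xs => checkH6x p et YS xs

/-- One `x`-arrangement out of a batched check. [folklore] -/
theorem checkH6x_of_xs {p : ℕ} {et : BTree} {YS XS : List (List ℕ)} {xs : List ℕ}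
    (h : checkH6xs p et YS XS = true) (hx : xs ∈ XS) : checkH6x p et YS xs = true := by
  rw [checkH6xs, List.all_eq_true] at h; exact h xs hx

/-- Family `c` from its `x`-arrangements. [folklore] -/
theorem checkH6c_of_x {p : ℕ} {et : BTree} {YS : List (List ℕ)} {k : List ℕ}
    (h : ∀ xs ∈ (arr6Y3 p k).filter sdX6, checkH6x p et YS xs = true) : checkH6c p et YS k = true := by
  rw [checkH6c, List.all_eq_true]; exact h

end Program

/-! ## Soundness of the family-`c` check -/

section Sound

variable {p : ℕ} [Fact p.Prime]

omit [Fact p.Prime] in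
/-- A relabelling fixing `0, 2, 3` that sorts the values at positions `1, 4, 5`. [folklore] -/
theorem exists_sort145 (x : Fin 6 → ZMod p) : ∃ σ : Equiv.Perm (Fin 6), (σ 0 = 0 ∧ σ 2 = 2 ∧ σ 3 = 3) ∧
    (x (σ 1)).val ≤ (x (σ 4)).val ∧ (x (σ 4)).val ≤ (x (σ 5)).val := by
  rcases le_total (x 1).val (x 4).val with hab | hba
  · rcases le_total (x 4).val (x 5).val with hbc | hcb
    · exact ⟨1, by decide, hab, hbc⟩
    · rcases le_total (x 1).val (x 5).val with hac | hca
      · refine ⟨Equiv.swap 4 5, by decide, ?_, ?_⟩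
        · rw [show Equiv.swap (4 : Fin 6) 5 1 = 1 from by decide, show Equiv.swap (4 : Fin 6) 5 4 = 5 from by decide]
          exact hac
        · rw [show Equiv.swap (4 : Fin 6) 5 4 = 5 from by decide, show Equiv.swap (4 : Fin 6) 5 5 = 4 from by decide]
          exact hcb
      · refine ⟨(Equiv.swap 1 4).trans (Equiv.swap 4 5), by decide, ?_, ?_⟩
        · rw [show ((Equiv.swap (1 : Fin 6) 4).trans (Equiv.swap 4 5)) 1 = 5 from by decide,
            show ((Equiv.swap (1 : Fin 6) 4).trans (Equiv.swap 4 5)) 4 = 1 from by decide]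
          exact hca
        · rw [show ((Equiv.swap (1 : Fin 6) 4).trans (Equiv.swap 4 5)) 4 = 1 from by decide,
            show ((Equiv.swap (1 : Fin 6) 4).trans (Equiv.swap 4 5)) 5 = 4 from by decide]
          exact hab
  · rcases le_total (x 1).val (x 5).val with hac | hca
    · refine ⟨Equiv.swap 1 4, by decide, ?_, ?_⟩
      · rw [show Equiv.swap (1 : Fin 6) 4 1 = 4 from by decide, show Equiv.swap (1 : Fin 6) 4 4 = 1 from by decide]
        exact hba
      · rw [show Equiv.swap (1 : Fin 6) 4 4 = 1 from by decide, show Equiv.swap (1 : Fin 6) 4 5 = 5 from by decide]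
        exact hac
    · rcases le_total (x 4).val (x 5).val with hbc | hcb
      · refine ⟨(Equiv.swap 4 5).trans (Equiv.swap 1 4), by decide, ?_, ?_⟩
        · rw [show ((Equiv.swap (4 : Fin 6) 5).trans (Equiv.swap 1 4)) 1 = 4 from by decide,
            show ((Equiv.swap (4 : Fin 6) 5).trans (Equiv.swap 1 4)) 4 = 5 from by decide]
          exact hbc
        · rw [show ((Equiv.swap (4 : Fin 6) 5).trans (Equiv.swap 1 4)) 4 = 5 from by decide,
            show ((Equiv.swap (4 : Fin 6) 5).trans (Equiv.swap 1 4)) 5 = 1 from by decide]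
          exact hca
      · refine ⟨Equiv.swap 1 5, by decide, ?_, ?_⟩
        · rw [show Equiv.swap (1 : Fin 6) 5 1 = 5 from by decide, show Equiv.swap (1 : Fin 6) 5 4 = 4 from by decide]
          exact hcb
        · rw [show Equiv.swap (1 : Fin 6) 5 4 = 4 from by decide, show Equiv.swap (1 : Fin 6) 5 5 = 1 from by decide]
          exact hba

/-- `sdX6 (vals6 x)` for a tuple whose only coincidence is `x₀ = x₃` and whose positions `1,4,5` are sorted. [folklore] -/
theorem sdX6_vals (x : Fin 6 → ZMod p)
    (hsep : ∀ a b : Fin 6, a ≠ b → x a = x b → (a = 0 ∧ b = 3) ∨ (a = 3 ∧ b = 0))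
    (h14 : (x 1).val < (x 4).val) (h45 : (x 4).val < (x 5).val) : sdX6 (vals6 x) = true := by
  have g1 : (vals6 x).getD 1 0 = (x 1).val := rfl
  have g4 : (vals6 x).getD 4 0 = (x 4).val := rfl
  have g5 : (vals6 x).getD 5 0 = (x 5).val := rfl
  rw [sdX6, Bool.and_eq_true, Bool.and_eq_true, List.all_eq_true, decide_eq_true_eq, decide_eq_true_eq, g1, g4, g5]
  refine ⟨fun ij hij => ?_, h14, h45⟩
  rw [Bool.or_eq_true]
  by_cases h : ij = (0, 3)
  · left; rw [h]; decide
  · right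
    obtain ⟨hi, hj, hne⟩ := pairs15_spec ij hij
    have hlt := pairs15_lt ij hij
    rw [Bool.not_eq_true', beq_eq_false_iff_ne, getD_vals6 x ⟨ij.1, hi⟩, getD_vals6 x ⟨ij.2, hj⟩]
    intro e
    have e' := ZMod.val_injective p e
    rcases hsep ⟨ij.1, hi⟩ ⟨ij.2, hj⟩ (fun h' => hne (by simpa using congrArg Fin.val h')) e' with ⟨h1, h2⟩ | ⟨h1, h2⟩
    · exact h (Prod.ext (by simpa using congrArg Fin.val h1) (by simpa using congrArg Fin.val h2))
    · have h1' : ij.1 = 3 := by simpa using congrArg Fin.val h1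
      have h2' : ij.2 = 0 := by simpa using congrArg Fin.val h2
      omega

/-- `dY6 (vals6 y)` for a tuple whose only coincidence is `y₀ = y₂`. [folklore] -/
theorem dY6_vals (y : Fin 6 → ZMod p)
    (hsep : ∀ a b : Fin 6, a ≠ b → y a = y b → (a = 0 ∧ b = 2) ∨ (a = 2 ∧ b = 0)) : dY6 (vals6 y) = true := by
  rw [dY6, List.all_eq_true]
  intro ij hij
  rw [Bool.or_eq_true]
  by_cases h : ij = (0, 2)
  · left; rw [h]; decide
  · right
    obtain ⟨hi, hj, hne⟩ := pairs15_spec ij hij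
    have hlt := pairs15_lt ij hij
    rw [Bool.not_eq_true', beq_eq_false_iff_ne, getD_vals6 y ⟨ij.1, hi⟩, getD_vals6 y ⟨ij.2, hj⟩]
    intro e
    have e' := ZMod.val_injective p e
    rcases hsep ⟨ij.1, hi⟩ ⟨ij.2, hj⟩ (fun h' => hne (by simpa using congrArg Fin.val h')) e' with ⟨h1, h2⟩ | ⟨h1, h2⟩
    · exact h (Prod.ext (by simpa using congrArg Fin.val h1) (by simpa using congrArg Fin.val h2))
    · have h1' : ij.1 = 2 := by simpa using congrArg Fin.val h1
      have h2' : ij.2 = 0 := by simpa using congrArg Fin.val h2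
      omega

/-- **Soundness of the family-`c` check** (hypothesis `h3c` of `exists_goodS_wide`): scale `x` and `y` into the representatives,
sort positions `1,4,5` of the scaled `x` by a relabelling fixing `0,2,3`, read off a good pair from the check, and transport it
back (keys are invariant under relabellings, `key6_perm`, and under the unscaling, `unscale_pair6`). [folklore] -/
theorem h3c_of_checkH6c {E R : List (List ℕ)} {et : BTree} {YS : List (List ℕ)}
    (hE2 : ∀ k ∈ E, ∀ κ : ℕ, 1 ≤ κ → κ < p → scaleVec p κ k ∈ E)
    (hR : ∀ k ∈ E, ∃ κ : ℕ, 1 ≤ κ ∧ κ < p ∧ scaleVec p κ k ∈ R) (hEt : ∀ k ∈ E, et.mem (polyBE 7 k) = true)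
    (hYS : ∀ k ∈ R, ∀ ys ∈ arr6Y2 p k, dY6 ys = true → ys ∈ YS) (hchk : ∀ k ∈ R, checkH6c p et YS k = true)
    (x y : Fin 6 → ZMod p) (h03 : x 0 = x 3)
    (hxsep : ∀ a b : Fin 6, a ≠ b → x a = x b → (a = 0 ∧ b = 3) ∨ (a = 3 ∧ b = 0)) (hxE : key6 x ∈ E)
    (h02 : y 0 = y 2) (hysep : ∀ a b : Fin 6, a ≠ b → y a = y b → (a = 0 ∧ b = 2) ∨ (a = 2 ∧ b = 0))
    (hyE : key6 y ∈ E) :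
    ∃ i j : Fin 6, (x i, y i) ≠ (x j, y j) ∧ key6 (fun k => (y i - y j) * x k - (x i - x j) * y k) ∉ E := by
  obtain ⟨κ, hκ, hxR⟩ := exists_smul_mem_R6 hR x hxE
  obtain ⟨μ, hμ, hyR⟩ := exists_smul_mem_R6 hR y hyE
  set x' : Fin 6 → ZMod p := fun i => κ * x i with hx'
  set y' : Fin 6 → ZMod p := fun i => μ * y i with hy'
  have hx'sep : ∀ a b : Fin 6, a ≠ b → x' a = x' b → (a = 0 ∧ b = 3) ∨ (a = 3 ∧ b = 0) :=
    fun a b hab e => hxsep a b hab (mul_left_cancel₀ hκ e)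
  have hy'sep : ∀ a b : Fin 6, a ≠ b → y' a = y' b → (a = 0 ∧ b = 2) ∨ (a = 2 ∧ b = 0) :=
    fun a b hab e => hysep a b hab (mul_left_cancel₀ hμ e)
  -- sort positions 1, 4, 5 of `x'`
  obtain ⟨σ, ⟨hσ0, hσ2, hσ3⟩, h14, h45⟩ := exists_sort145 x'
  set X : Fin 6 → ZMod p := fun i => x' (σ i) with hX
  set Y : Fin 6 → ZMod p := fun i => y' (σ i) with hY
  have hXsep : ∀ a b : Fin 6, a ≠ b → X a = X b → (a = 0 ∧ b = 3) ∨ (a = 3 ∧ b = 0) := by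
    intro a b hab e
    rcases hx'sep (σ a) (σ b) (fun h => hab (σ.injective h)) e with ⟨h1, h2⟩ | ⟨h1, h2⟩
    · exact Or.inl ⟨σ.injective (h1.trans hσ0.symm), σ.injective (h2.trans hσ3.symm)⟩
    · exact Or.inr ⟨σ.injective (h1.trans hσ3.symm), σ.injective (h2.trans hσ0.symm)⟩
  have hYsep : ∀ a b : Fin 6, a ≠ b → Y a = Y b → (a = 0 ∧ b = 2) ∨ (a = 2 ∧ b = 0) := by
    intro a b hab e
    rcases hy'sep (σ a) (σ b) (fun h => hab (σ.injective h)) e with ⟨h1, h2⟩ | ⟨h1, h2⟩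
    · exact Or.inl ⟨σ.injective (h1.trans hσ0.symm), σ.injective (h2.trans hσ2.symm)⟩
    · exact Or.inr ⟨σ.injective (h1.trans hσ2.symm), σ.injective (h2.trans hσ0.symm)⟩
  have hX03 : X 0 = X 3 := by
    show x' (σ 0) = x' (σ 3); rw [hσ0, hσ3]; simp only [hx', h03]
  have hY02 : Y 0 = Y 2 := by
    show y' (σ 0) = y' (σ 2); rw [hσ0, hσ2]; simp only [hy', h02]
  have h14' : (X 1).val < (X 4).val := by
    refine lt_of_le_of_ne h14 fun e => ?_
    rcases hXsep 1 4 (by decide) (ZMod.val_injective p e) with ⟨h, -⟩ | ⟨h, -⟩ <;> exact absurd h (by decide)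
  have h45' : (X 4).val < (X 5).val := by
    refine lt_of_le_of_ne h45 fun e => ?_
    rcases hXsep 4 5 (by decide) (ZMod.val_injective p e) with ⟨h, -⟩ | ⟨h, -⟩ <;> exact absurd h (by decide)
  have hkX : key6 X = key6 x' := key6_perm x' σ
  have hkY : key6 Y = key6 y' := key6_perm y' σ
  -- read the check
  have h1 := hchk _ hxR
  rw [checkH6c, List.all_eq_true] at h1
  have hmemX : vals6 X ∈ (arr6Y3 p (key6 x')).filter sdX6 :=
    List.mem_filter.2 ⟨vals_mem_arr6Y3 X hX03 hkX, sdX6_vals X hXsep h14' h45'⟩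
  have h2 := h1 _ hmemX
  rw [List.all_eq_true] at h2
  have hpg := h2 _ (hYS _ hyR _ (vals_mem_arr6Y2 Y hY02 hkY) (dY6_vals Y hYsep))
  obtain ⟨i, j, hne, hm⟩ := exists_pair_of_pairGood6 hEt X Y hpg
  refine ⟨σ i, σ j, unscale_pair6 hE2 x y hκ hμ hne ?_⟩
  have e : (fun k => (Y i - Y j) * X k - (X i - X j) * Y k) =
      fun k => (fun m => (μ * y (σ i) - μ * y (σ j)) * (κ * x m) - (κ * x (σ i) - κ * x (σ j)) * (μ * y m)) (σ k) := by
    funext k; rfl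
  rw [e, key6_perm (fun m => (μ * y (σ i) - μ * y (σ j)) * (κ * x m) - (κ * x (σ i) - κ * x (σ j)) * (μ * y m)) σ] at hm
  exact hm

end Sound

/-! ## Assembly -/

section Assembly

variable {p : ℕ} [Fact p.Prime]

/-- **Structural cover theorem for part `6`, every odd prime `p`**, all hypotheses on `E, R` as Bool checks plus the
tree-completeness and arrangement-completeness facts (`YSc`: the `y`-arrangements `arr6Y2` of the representatives that pass
`dY6`): every value function `g` of sum `6` on the `p²` points has a direction `j ≤ p`, a unit `k` and an entry `e ∈ T` with
`e.1[(k·v) % p] = (count of g along j at v)`. [folklore] -/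
theorem exists_entry_structSixWide_of_checks (E R : List (List ℕ)) (g₀ : ℕ) (et : BTree)
    (YSa YSb YSc : List (List ℕ)) (h1 : checkE1six E = true) (h2 : checkE2g p g₀ E = true) (hR : checkR6 p E R = true)
    (hEt : ∀ k ∈ E, et.mem (polyBE 7 k) = true)
    (hYSa : ∀ k ∈ R, ∀ ys ∈ arr6Y3 p k, ys ∈ YSa) (hYSb : ∀ k ∈ R, ∀ ys ∈ arr6Y2 p k, ys ∈ YSb)
    (hYSc : ∀ k ∈ R, ∀ ys ∈ arr6Y2 p k, dY6 ys = true → ys ∈ YSc)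
    (h3a : ∀ k ∈ R, checkH6a p et YSa k = true) (h3b : ∀ k ∈ R, checkH6b p et YSb k = true)
    (h3c : ∀ k ∈ R, checkH6c p et YSc k = true)
    (T : List (List ℕ × List (ℕ × List ℕ))) (tt : BTree)
    (htt : ∀ x, tt.mem x = true → x ∈ T.map fun e => polyBE 7 e.1) (hWF : tabWF p 7 T = true)
    (hEwf : checkEwf6 p E = true) (hEt' : ∀ x, et.mem x = true → x ∈ E.map (polyBE 7))
    (hchk : checkSix p et tt = true) (g : Fin (p * p) → ℕ) (hg : ∑ i, g i = 6) :
    ∃ j < p + 1, ∃ k : ℕ, k % p ≠ 0 ∧ ∃ e ∈ T, ∀ v < p,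
      e.1.getD (k * v % p) 0 = ∑ i : Fin (p * p), pick v (pv p j i.val) (g i) := by
  haveI : NeZero p := ⟨(Fact.out : p.Prime).ne_zero⟩
  have hE1 := hE1six_of_check h1
  have hE2 := hE2_of_checkE2g h2
  have hR' := hR6_of_check hR
  set H : ZMod p × ZMod p → ℕ := fun w => g ((ptEquiv p).symm w) with hH
  have hsum : ∑ w, H w = 6 := by
    rw [← hg]
    exact Fintype.sum_equiv (ptEquiv p).symm H g fun w => rfl
  obtain ⟨u, hu⟩ := exists_tuple_of_sum_eq 6 H hsum
  obtain ⟨j, hj, σ, h01, hgood⟩ := exists_goodS_wide E hE1 hE2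
    (h3a_of_checkH6a hE2 hR' hEt hYSa h3a) (h3b_of_checkH6b hE2 hR' hEt hYSb h3b)
    (h3c_of_checkH6c hE2 hR' hEt hYSc h3c) u
  have hcnt : ∀ v < p, ∑ i : Fin (p * p), pick v (pv p j i.val) (g i) =
      ∑ i : Fin 6, if lineDir p j (u (σ i)) = ((v : ℕ) : ZMod p) then 1 else 0 := by
    intro v hv
    have e1 := sum_filter_eq_sum_pick p j H hv
    have e2 : ∀ i : Fin (p * p), H (pt p i.val) = g i := fun i => by
      show g ((ptEquiv p).symm (ptEquiv p i)) = g i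
      rw [Equiv.symm_apply_apply]
    simp only [e2] at e1
    rw [← e1]
    simp only [hu]
    rw [sum_filter_tuple_count u (lineDir p j) ((v : ℕ) : ZMod p)]
    exact (Equiv.sum_comp σ (fun i => if lineDir p j (u i) = ((v : ℕ) : ZMod p) then 1 else 0)).symm
  obtain ⟨κ, hκ, e, he, hev⟩ :=
    exists_entry_of_goodS hE2 htt hWF hEwf hEt' hchk (a := fun i => lineDir p j (u (σ i))) h01 hgood
  refine ⟨j, hj, κ.val, ?_, e, he, fun v hv => ?_⟩
  · rw [Nat.mod_eq_of_lt (ZMod.val_lt κ)]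
    exact (ZMod.val_ne_zero κ).2 hκ
  · rw [hcnt v hv, Fin.sum_univ_six]
    have h1 := hev ((v : ℕ) : ZMod p)
    rw [ZMod.val_mul, ZMod.val_natCast, Nat.mod_eq_of_lt hv] at h1
    exact h1

end Assembly

end ZpZpDomino

end Summit.MatrixMultiplication.OmegaCensus
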